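import Summits.Ventures.HodgeRepro2.T6Host

/-!
# T6HostLemmas — first consequences of the (S4) object (t6-lead g3)

Kernel facts about `CornerProduct`: `avHom` is functorial, pull-backs compose, and the induced `K`-action
on `H¹(B(ℂ), ℚ)` is intertwined with the factors' actions by the projections (`act_pull`): on the order by
`endo_pr` + `act_endo`, on all of `K` by clearing denominators (`exists_natCast_mul_mem`).
§8(d): uses an L-value-free non-vanishing device: NO.
-/

noncomputable section

open CategoryTheory
open scoped TensorProduct
open HostAPI.Carriers.AlgebraicGeometry.Motives

namespace Summit.Ventures.HodgeRepro2.T6.Host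

/-- The underlying scheme morphism of a composite of abelian-variety morphisms is the composite (by `rfl`). -/
theorem avHom_comp {A B C : AbelianVariety ℂ} (f : A ⟶ B) (g : B ⟶ C) :
    avHom (f ≫ g) = avHom f ≫ avHom g := rfl

/-- Functoriality of the host's ℚ-Betti pull-back: `(f ≫ g)^* = f^* ∘ g^*` in every degree
(`bettiCohomology.map_comp`). -/
theorem pullQ_comp {X Y Z : SchemeOver ℂ} (f : X ⟶ Y) (g : Y ⟶ Z) (i : ℕ) :
    pullQ (f ≫ g) i = pullQ f i ∘ₗ pullQ g i := by
  show (bettiCohomology.map (f ≫ g) i).hom = _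
  rw [bettiCohomology.map_comp]
  rfl

/-- Functoriality of the ℚ-Betti pull-back along morphisms of abelian varieties (from `pullQ_comp`). -/
theorem avPullQ_comp {A B C : AbelianVariety ℂ} (f : A ⟶ B) (g : B ⟶ C) (i : ℕ) :
    avPullQ (f ≫ g) i = avPullQ f i ∘ₗ avPullQ g i :=
  pullQ_comp (avHom f) (avHom g) i

namespace CornerProduct

variable {K : Type} [Field K] [NumberField K] [NumberField.IsCMField K] (C : CornerProduct K)

/-- On the order, the projections intertwine the actions on `H¹`. -/
theorem act_pull_of_mem (i : Fin 4) (x : C.O') :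
    C.act x ∘ₗ avPullQ (C.pr i) 1 = avPullQ (C.pr i) 1 ∘ₗ (C.A i).act x := by
  have h2 : (C.A i).act (x : K) = avPullQ ((C.A i).endo ⟨x, C.O'_le i x.2⟩) 1 :=
    (C.A i).act_endo ⟨x, C.O'_le i x.2⟩
  rw [C.act_endo x, h2, ← avPullQ_comp, ← avPullQ_comp, C.endo_pr i x]

/-- The projections intertwine the induced `K`-actions on `H¹` (`act_pull_of_mem` + clearing denominators). -/
theorem act_pull (i : Fin 4) (x : K) :
    C.act x ∘ₗ avPullQ (C.pr i) 1 = avPullQ (C.pr i) 1 ∘ₗ (C.A i).act x := by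
  obtain ⟨n, hn, hnx⟩ := C.exists_natCast_mul_mem x
  have h : C.act ((n : K) * x) ∘ₗ avPullQ (C.pr i) 1 = avPullQ (C.pr i) 1 ∘ₗ (C.A i).act ((n : K) * x) :=
    C.act_pull_of_mem i ⟨(n : K) * x, hnx⟩
  have hn' : (n : ℚ) ≠ 0 := by exact_mod_cast hn.ne'
  rw [map_mul, map_mul, map_natCast, map_natCast, ← nsmul_eq_mul, ← nsmul_eq_mul,
    ← Nat.cast_smul_eq_nsmul ℚ, ← Nat.cast_smul_eq_nsmul ℚ, LinearMap.smul_comp, LinearMap.comp_smul] at h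
  exact smul_right_injective _ hn' h

end CornerProduct

end Summit.Ventures.HodgeRepro2.T6.Host

end
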